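import Literature.NumberTheory.GaloisCohomology.Howard2004.TransportUnramified
import Literature.NumberTheory.GaloisCohomology.Howard2004.CohomologyMapBijectiveTransportProofs
import Literature.NumberTheory.EllipticCurves.ZpExtensionEisensteinSelmerStructure
import Literature.NumberTheory.EllipticCurves.IwasawaTwistModPkTower
import HarnessLib

/-!
# The transport of H.5(b) is bijective on `H¹` and carries `ker H¹(K_v̄, j)` onto `ker H¹(K_v, j)` for a
# `G_ℚ`-structure compatible with `j` (theorems only)

`Proofs` file (theorems only; no definition, no named fact, no instance, no `sorry`).  Companion of
`TransportUnramified` (x9-p1-w4: the transport `H¹(K_v̄, T) ≅ H¹(K_v, Tw T)` of a conjugation datum carries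
`H¹_ur` to `H¹_ur`) and `PropagateUnramifiedProofs` (x9-p1-w3 g4) towards Howard's hypothesis **H.5(b)** —
«the condition `F` propagated to `T̄` is stable under the action of `G_ℚ`»: at every finite `v`,
`(θ_v ∘ transport_v)(F̄_{v̄}) = F̄_v` [B. Howard, Compositio Math. 140 (2004), §1.3, arXiv:1202.6340 p. 7 L96–97] — at
the places of `S`, where (cell `pub/bsd-print-x9`, memo `HOME/x9-p1-w3/H5B-AT-S-PLAN-w3g5.md`, steps (L1)–(L3)) the
residual image of the saturated condition is a KERNEL `ker (H¹(K_v, T̄) → H¹(K_v, W₁))` of `H¹` of an equivariant map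
`j : T̄ → W₁` (the top graded piece `×T^{m-1}` of the bottom Eisenstein level), and `W₁` carries its own `G_ℚ`-structure
`Θ₁ = τ ⊗ ι` compatible with `j` and with `θ = τ` on `T̄`.

* §1 **`ConjugationDatum.transportH1_injective` / `transportH1_surjective`** — «conjugation by `τ` induces an
  isomorphism `H¹(K_v̄, T) ≅ H¹(K_v, Tw(T))`» (arXiv p. 7 L48–50): the pull-back along the bijection `φ_v` with the
  coefficient map `δ_v` has the inverse `[d] ↦ [g ↦ δ_v⁻¹ d(φ_v⁻¹ g)]` (`φ_v⁻¹` continuous: `exists_continuous_inverse_phi`).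
* §2 **`map_localMap_thetaH1_transportH1`** — naturality: for a `G_ℚ`-structure `θ` on `T̄` (`ResidualTau`), an additive
  bijection `Θ₁` of `W₁` with `Θ₁ ∘ ρ₁(τ⁻¹gτ) = ρ₁(g) ∘ Θ₁` and an equivariant `j : T̄ → W₁` with `Θ₁ ∘ j = j ∘ θ`:
  `H¹(j_v) ∘ (θ_v ∘ transport_v^{T̄}) = (Θ₁,v ∘ transport_v^{W₁}) ∘ H¹(j_v̄)` on `H¹(K_v̄, T̄)`.
* §3 **`map_thetaH1_comp_transportH1_ker_eq`** — hence `(θ_v ∘ transport_v)(ker H¹(j_v̄)) = ker H¹(j_v)` (both composites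
  are bijective, `bijective_cohomologyMap_of_bijective`).

Seat `bsd-line-x9-p1-w3` g5.  No summit statement is proved; BSD is not proved by any of this.

References: [Howard2004HeegnerKolyvagin] §1.3 (arXiv:1202.6340 p. 7 L33–50, L93–97); [SerreGaloisCohomology1997] I §2.2,
§2.4 (compatible pairs), §5.8; [NeukirchSchmidtWingberg2008] (1.5.2).
-/

noncomputable section

open Function NumberField IsDedekindDomain Field
open scoped NumberField ContRepresentation

namespace Literature.NumberTheory.GaloisCohomology.Howard2004

open Literature.NumberTheory.GaloisRepresentations Literature.NumberTheory.GaloisRepresentations.DiscreteGaloisModule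
open Literature.NumberTheory.EllipticCurves

namespace ConjugationDatum

variable {K : Type} [Field K] [NumberField K] {M : Type} [AddCommGroup M] [TopologicalSpace M]
  [DiscreteTopology M]

/-! ## §1 The transport is bijective on `H¹` -/

/-- The compatibility of the datum solved for `δ_v⁻¹`: `δ_v⁻¹ · (τ⁻¹ res_v(ψ g) τ) = res_v̄(g) · δ_v⁻¹` for an inverse
`ψ` of `φ_v`. [cite: Howard2004HeegnerKolyvagin, §1.3 (arXiv p. 7, L44–48)] -/
theorem delta_inv_mul_conj_eq (cd : ConjugationDatum K) (v : HeightOneSpectrum (𝓞 K))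
    {ψ : absoluteGaloisGroup ((cd.σ • v).adicCompletion K) → absoluteGaloisGroup (v.adicCompletion K)}
    (hφψ : ∀ g, cd.φ v (ψ g) = g) (g : absoluteGaloisGroup ((cd.σ • v).adicCompletion K)) :
    (cd.δ v)⁻¹ * cd.conj (absGaloisRestrict K (v.adicCompletion K) (ψ g)) =
      absGaloisRestrict K ((cd.σ • v).adicCompletion K) g * (cd.δ v)⁻¹ := by
  rw [cd.conj_absGaloisRestrict_eq v (ψ g), hφψ]; group

/-- **The transport `H¹(K_v̄, T) → H¹(K_v, Tw T)` is injective**: if `h ↦ δ_v c(φ_v h)` is principal for the twisted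
action, `= h·m − m`, then `c(g) = g·(δ_v⁻¹ m) − δ_v⁻¹ m` (`φ_v` is onto).
[cite: Howard2004HeegnerKolyvagin, §1.3 (arXiv p. 7, L48–50: «induces an isomorphism»)] [cite: SerreGaloisCohomology1997, I §2.4] -/
theorem transportH1_injective (cd : ConjugationDatum K) (ρ : DiscreteGaloisModule K M) (v : HeightOneSpectrum (𝓞 K)) :
    Function.Injective (cd.transportH1 ρ v) := by
  refine (injective_iff_map_eq_zero _).mpr fun x hx ↦ ?_
  obtain ⟨c, rfl⟩ := oneCocycleClass_surjective _ x
  obtain ⟨ψ, hφψ, hψφ, hmul⟩ := cd.exists_continuous_inverse_phi v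
  rw [transportH1_oneCocycleClass] at hx
  obtain ⟨m, hm⟩ := (oneCocycleClass_eq_zero_iff _ _).mp hx
  refine (oneCocycleClass_eq_zero_iff _ _).mpr ⟨ρ (cd.δ v)⁻¹ m, fun g ↦ ?_⟩
  have hg := hm (ψ g)
  rw [contOneCocycles.pullback_apply, hφψ, transportHom_hom_apply] at hg
  -- `δ c(g) = (τ⁻¹ res_v(ψ g) τ) m − m`
  change ρ.toRepresentation (cd.δ v) (c.1 g) =
    ρ.toRepresentation (cd.conj (absGaloisRestrict K (v.adicCompletion K) (ψ g))) m - m at hg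
  change c.1 g = ρ.toRepresentation (absGaloisRestrict K ((cd.σ • v).adicCompletion K) g) (ρ.toRepresentation (cd.δ v)⁻¹ m) -
    ρ.toRepresentation (cd.δ v)⁻¹ m
  have hc : c.1 g = ρ.toRepresentation (cd.δ v)⁻¹ (ρ.toRepresentation (cd.δ v) (c.1 g)) := by
    rw [← Module.End.mul_apply, ← map_mul, inv_mul_cancel, map_one, Module.End.one_apply]
  rw [hc, hg, map_sub, ← Module.End.mul_apply, ← map_mul, cd.delta_inv_mul_conj_eq v hφψ g, map_mul,
    Module.End.mul_apply]

/-- **The transport `H¹(K_v̄, T) → H¹(K_v, Tw T)` is surjective**: a cocycle `d` of `Tw T` on `Γ_{K_v}` is the transport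
of `g ↦ δ_v⁻¹ d(φ_v⁻¹ g)` (`φ_v` is a continuous bijection of compact groups, hence a homeomorphism).
[cite: Howard2004HeegnerKolyvagin, §1.3 (arXiv p. 7, L48–50: «induces an isomorphism»)] [cite: SerreGaloisCohomology1997, I §2.4] -/
theorem transportH1_surjective (cd : ConjugationDatum K) (ρ : DiscreteGaloisModule K M) (v : HeightOneSpectrum (𝓞 K)) :
    Function.Surjective (cd.transportH1 ρ v) := by
  intro y
  change galoisCohomology (GaloisRep.toLocal v (cd.twist ρ)) 1 at y
  obtain ⟨d, rfl⟩ := oneCocycleClass_surjective (GaloisRep.toLocal v (cd.twist ρ)).toTopRep y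
  obtain ⟨ψ, hφψ, hψφ, hmul⟩ := cd.exists_continuous_inverse_phi v
  have hcomm : ∀ (g : absoluteGaloisGroup ((cd.σ • v).adicCompletion K)) (y : M),
      ρ.toRepresentation (cd.δ v)⁻¹ (ρ.toRepresentation (cd.conj (absGaloisRestrict K (v.adicCompletion K) (ψ g))) y) =
        ρ.toRepresentation (absGaloisRestrict K ((cd.σ • v).adicCompletion K) g) (ρ.toRepresentation (cd.δ v)⁻¹ y) :=
    fun g y ↦ by
      rw [← Module.End.mul_apply, ← map_mul, cd.delta_inv_mul_conj_eq v hφψ g, map_mul, Module.End.mul_apply]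
  -- the cocycle `c(g) = δ_v⁻¹ · d(ψ g)` of `T` on `Γ_{K_v̄}`
  let c : contOneCocycles (GaloisRep.toLocal (cd.σ • v) ρ).toTopRep :=
    ⟨⟨fun g ↦ ρ (cd.δ v)⁻¹ (d.1 (ψ g)), continuous_of_discreteTopology.comp (d.1.continuous.comp ψ.continuous)⟩,
      fun g g' ↦ by
        change ρ.toRepresentation (cd.δ v)⁻¹ (d.1 (ψ (g * g'))) =
          ρ.toRepresentation (cd.δ v)⁻¹ (d.1 (ψ g)) +
            ρ.toRepresentation (absGaloisRestrict K ((cd.σ • v).adicCompletion K) g)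
              (ρ.toRepresentation (cd.δ v)⁻¹ (d.1 (ψ g')))
        rw [hmul, d.2 (ψ g) (ψ g')]
        change ρ.toRepresentation (cd.δ v)⁻¹ (d.1 (ψ g) +
            ρ.toRepresentation (cd.conj (absGaloisRestrict K (v.adicCompletion K) (ψ g))) (d.1 (ψ g'))) = _
        rw [map_add, hcomm]⟩
  refine ⟨oneCocycleClass _ c, ?_⟩
  rw [transportH1_oneCocycleClass]
  have hc : contOneCocycles.pullback (cd.φ v) (cd.transportHom ρ v) c = d := by
    refine Subtype.ext (ContinuousMap.ext fun h ↦ ?_)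
    change ρ.toRepresentation (cd.δ v) (ρ.toRepresentation (cd.δ v)⁻¹ (d.1 (ψ (cd.φ v h)))) = d.1 h
    rw [hψφ, ← Module.End.mul_apply, ← map_mul, mul_inv_cancel, map_one, Module.End.one_apply]
  rw [hc]
  rfl

/-- The transport is bijective on `H¹`. [cite: Howard2004HeegnerKolyvagin, §1.3 (arXiv p. 7, L48–50)] -/
theorem transportH1_bijective (cd : ConjugationDatum K) (ρ : DiscreteGaloisModule K M) (v : HeightOneSpectrum (𝓞 K)) :
    Function.Bijective (cd.transportH1 ρ v) :=
  ⟨cd.transportH1_injective ρ v, cd.transportH1_surjective ρ v⟩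

end ConjugationDatum

/-! ## §2 Naturality of `θ_v ∘ transport_v` in an equivariant map compatible with the `G_ℚ`-structures -/

section Naturality

variable {K : Type} [Field K] [NumberField K] (cd : ConjugationDatum K)
  {N : Type} [AddCommGroup N] [TopologicalSpace N] [DiscreteTopology N]
  {M₁ : Type} [AddCommGroup M₁] [TopologicalSpace M₁] [DiscreteTopology M₁]
  {R : Type} [CommRing R] [Module R N]
  (ρN : DiscreteGaloisModule K N) (ρ₁ : DiscreteGaloisModule K M₁) (A : ResidualTau (R := R) cd ρN)
  (jg : ρN.toContRepresentation →ⁱL ρ₁.toContRepresentation) (Θ₁ : M₁ →+ M₁)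

/-- The local equivariance of `Θ₁` for the twisted action (restriction of the global one).
[cite: Howard2004HeegnerKolyvagin, §1.3 H.5(a) (arXiv p. 7, L93–95)] -/
theorem twist_toLocal_equivariant (hΘ₁ : ∀ (g : absoluteGaloisGroup K) (x : M₁), Θ₁ (ρ₁ (cd.conj g) x) = ρ₁ g (Θ₁ x))
    (v : HeightOneSpectrum (𝓞 K)) (g : absoluteGaloisGroup (Place.Completion (Sum.inr v : Place K)))
    (x : M₁) : Θ₁ (((cd.twist ρ₁).toLocal (Sum.inr v)) g x) = (ρ₁.toLocal (Sum.inr v)) g (Θ₁ x) :=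
  hΘ₁ _ x

/-- **Naturality**: `H¹(j_v) (θ_v (transport_v z)) = Θ₁,v (transport_v (H¹(j_v̄) z))` for `z ∈ H¹(K_v̄, T̄)`, when
`Θ₁ ∘ j = j ∘ θ` (`j` being `Γ_K`-equivariant it commutes with `δ_v`; all four maps are pull-backs of cocycles).
[cite: Howard2004HeegnerKolyvagin, §1.3 H.5(b) (arXiv p. 7, L96–97)] [cite: SerreGaloisCohomology1997, I §2.4 (compatible pairs)] -/
theorem map_localMap_thetaH1_transportH1
    (hΘ₁ : ∀ (g : absoluteGaloisGroup K) (x : M₁), Θ₁ (ρ₁ (cd.conj g) x) = ρ₁ g (Θ₁ x))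
    (hΘj : ∀ x, Θ₁ (jg x) = jg (A.θ x)) (v : HeightOneSpectrum (𝓞 K))
    (z : galoisCohomology (ρN.toLocal (Sum.inr (cd.σ • v))) 1) :
    galoisCohomology.map (DiscreteGaloisModule.localMap jg (Sum.inr v)) 1 (A.thetaH1 (Sum.inr v) (cd.transportH1 ρN v z)) =
      ContinuousRep.cohomologyMap ((cd.twist ρ₁).toLocal (Sum.inr v)) (ρ₁.toLocal (Sum.inr v)) Θ₁
          continuous_of_discreteTopology (twist_toLocal_equivariant cd ρ₁ Θ₁ hΘ₁ v) 1
        (cd.transportH1 ρ₁ v (galoisCohomology.map (DiscreteGaloisModule.localMap jg (Sum.inr (cd.σ • v))) 1 z)) := by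
  obtain ⟨ζ, rfl⟩ := oneCocycleClass_surjective _ z
  have e2 : ∀ c, A.thetaH1 (Sum.inr v) (oneCocycleClass _ c) = oneCocycleClass _
      (contOneCocycles.pullback (ContinuousMonoidHom.id _)
        (X := ((cd.twist ρN).toLocal (Sum.inr v)).toTopRep) (Y := (ρN.toLocal (Sum.inr v)).toTopRep)
        (TopRep.ofHom ⟨⟨A.θ.toAddMonoidHom.toIntLinearMap, continuous_of_discreteTopology⟩,
          fun g ↦ ContinuousLinearMap.ext fun x ↦ A.compat _ x⟩) c) := fun c ↦ map_oneCocycleClass _ _ _ c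
  have e5 : ∀ c, ContinuousRep.cohomologyMap ((cd.twist ρ₁).toLocal (Sum.inr v)) (ρ₁.toLocal (Sum.inr v)) Θ₁
      continuous_of_discreteTopology (twist_toLocal_equivariant cd ρ₁ Θ₁ hΘ₁ v) 1 (oneCocycleClass _ c) =
      oneCocycleClass _ (contOneCocycles.pullback (ContinuousMonoidHom.id _)
        (X := ((cd.twist ρ₁).toLocal (Sum.inr v)).toTopRep) (Y := (ρ₁.toLocal (Sum.inr v)).toTopRep)
        (TopRep.ofHom ⟨⟨Θ₁.toIntLinearMap, continuous_of_discreteTopology⟩,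
          fun g ↦ ContinuousLinearMap.ext fun x ↦ twist_toLocal_equivariant cd ρ₁ Θ₁ hΘ₁ v g x⟩) c) :=
    fun c ↦ map_oneCocycleClass _ _ _ c
  have L := (congrArg (galoisCohomology.map (DiscreteGaloisModule.localMap jg (Sum.inr v)) 1)
    ((congrArg (A.thetaH1 (Sum.inr v)) (ConjugationDatum.transportH1_oneCocycleClass cd ρN v ζ)).trans (e2 _))).trans
    (galoisCohomology.map_oneCocycleClass_ofHom _ _)
  have R := (congrArg (ContinuousRep.cohomologyMap ((cd.twist ρ₁).toLocal (Sum.inr v)) (ρ₁.toLocal (Sum.inr v)) Θ₁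
      continuous_of_discreteTopology (twist_toLocal_equivariant cd ρ₁ Θ₁ hΘ₁ v) 1)
    ((congrArg (cd.transportH1 ρ₁ v) (galoisCohomology.map_oneCocycleClass_ofHom
      (DiscreteGaloisModule.localMap jg (Sum.inr (cd.σ • v))) ζ)).trans
      (ConjugationDatum.transportH1_oneCocycleClass cd ρ₁ v _))).trans (e5 _)
  refine L.trans (Eq.trans ?_ R.symm)
  congr 1
  refine Subtype.ext (ContinuousMap.ext fun h ↦ ?_)
  change jg (A.θ (ρN (cd.δ v) (ζ.1 (cd.φ v h)))) = Θ₁ (ρ₁ (cd.δ v) (jg (ζ.1 (cd.φ v h))))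
  rw [← hΘj, show jg (ρN (cd.δ v) (ζ.1 (cd.φ v h))) = ρ₁ (cd.δ v) (jg (ζ.1 (cd.φ v h))) from
    congrArg (fun φ ↦ φ (ζ.1 (cd.φ v h))) (jg.isIntertwining' (cd.δ v))]

/-! ## §3 The transport carries `ker H¹(j_v̄)` onto `ker H¹(j_v)` -/

/-- **`(θ_v ∘ transport_v)(ker H¹(K_v̄, j)) = ker H¹(K_v, j)`** for a bijective `G_ℚ`-structure `Θ₁` of `W₁` compatible with
`j` and `θ` — the form in which H.5(b) holds for residual conditions that are kernels of `H¹(T̄) → H¹(W₁)` (the connecting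
images of `0 → T̄ → W₁ → W₁/T̄ → 0`). [cite: Howard2004HeegnerKolyvagin, §1.3 H.5(b) (arXiv p. 7, L96–97)]
[cite: SerreGaloisCohomology1997, I §2.2 and §2.4] -/
theorem map_thetaH1_comp_transportH1_ker_eq
    (hΘ₁ : ∀ (g : absoluteGaloisGroup K) (x : M₁), Θ₁ (ρ₁ (cd.conj g) x) = ρ₁ g (Θ₁ x))
    (hΘ₁b : Function.Bijective Θ₁) (hΘj : ∀ x, Θ₁ (jg x) = jg (A.θ x))
    (v : HeightOneSpectrum (𝓞 K)) :
    ((galoisCohomology.map (DiscreteGaloisModule.localMap jg (Sum.inr (cd.σ • v))) 1).ker).map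
        ((A.thetaH1 (Sum.inr v)).comp (cd.transportH1 ρN v)) =
      (galoisCohomology.map (DiscreteGaloisModule.localMap jg (Sum.inr v)) 1).ker := by
  have hθb : Function.Bijective (A.thetaH1 (Sum.inr v)) :=
    bijective_cohomologyMap_of_bijective ((cd.twist ρN).toLocal (Sum.inr v)) (ρN.toLocal (Sum.inr v))
      A.θ.toAddMonoidHom (fun g x ↦ A.compat _ x) (Function.Involutive.bijective A.involutive)
  have hΘb : Function.Bijective (ContinuousRep.cohomologyMap ((cd.twist ρ₁).toLocal (Sum.inr v)) (ρ₁.toLocal (Sum.inr v))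
      Θ₁ continuous_of_discreteTopology (twist_toLocal_equivariant cd ρ₁ Θ₁ hΘ₁ v) 1) :=
    bijective_cohomologyMap_of_bijective ((cd.twist ρ₁).toLocal (Sum.inr v)) (ρ₁.toLocal (Sum.inr v)) Θ₁
      (twist_toLocal_equivariant cd ρ₁ Θ₁ hΘ₁ v) hΘ₁b
  ext y
  constructor
  · rintro ⟨z, hz, rfl⟩
    have hz' : galoisCohomology.map (DiscreteGaloisModule.localMap jg (Sum.inr (cd.σ • v))) 1 z = 0 :=
      (AddMonoidHom.mem_ker).mp hz
    refine (AddMonoidHom.mem_ker).mpr ?_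
    rw [AddMonoidHom.comp_apply, map_localMap_thetaH1_transportH1 cd ρN ρ₁ A jg Θ₁ hΘ₁ hΘj v z, hz']
    exact (congrArg _ (map_zero (cd.transportH1 ρ₁ v))).trans (map_zero _)
  · intro hy
    have hy' : galoisCohomology.map (DiscreteGaloisModule.localMap jg (Sum.inr v)) 1 y = 0 :=
      (AddMonoidHom.mem_ker).mp hy
    obtain ⟨x, rfl⟩ := hθb.2 y
    obtain ⟨z, rfl⟩ := cd.transportH1_surjective ρN v x
    refine ⟨z, ?_, rfl⟩
    rw [map_localMap_thetaH1_transportH1 cd ρN ρ₁ A jg Θ₁ hΘ₁ hΘj v z] at hy'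
    refine (AddMonoidHom.mem_ker).mpr (cd.transportH1_injective ρ₁ v (hΘb.1 ?_))
    exact hy'.trans ((congrArg _ (map_zero (cd.transportH1 ρ₁ v))).trans (map_zero _)).symm

end Naturality

end Literature.NumberTheory.GaloisCohomology.Howard2004

end
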